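import Summits.AtomisticToContinuum.FouriersLaw.Theorems.OddSectorIrreversibilityBoundedResponseConvergesStubPositiveConductanceAux1

/-!
# Non-degeneracy of the Kubo corrector (helper II towards stub `stub_positiveConductance`,
# line `two-scale-gluing-log-rigidity`, crux stmt-AtomisticToContinuum-9141)

Second helper file for the registered stub `stub_positiveConductance` (P) (= `FeketeSeriesLaw.PositiveConductance`,
stmt-AtomisticToContinuum-11750: `D_N > 0` for `N ≥ 2`). STATUS of (P): blocked on the fixed-`N`
linear-response identity (LR) `(N-1)T²D_N·Z = ⟨u, J⟩_{μ_T} = γT(∫(∂_{p_0}u)² + ∫(∂_{p_{N-1}}u)²) dμ_T`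
for the Kubo corrector `u` of `J = Σ_i j_i` — conjuncts (B) and (A6) of the UNPROVED route item
`OddSectorIrreversibility.CorrectorTheory` (stmt-14071; (B) = `StaticAbelianSqueeze.KuboAbelIdentity`,
stmt-13419), not in the tree. This file proves the OTHER half, sorry-free:

* `corrector_nondegenerate` / `corrector_nondegeneracy` (registered form) — for the pinned chain
  (`β ≥ 0`, any `ω₂, lam, γ`, any bath temperatures) with `N ≥ 2`, a `C²` solution `u` of the
  corrector equation `L u = -J` cannot have both contact momentum derivatives identically zero:
  otherwise the bath terms of `L` are silent, `L u = {H, u}`, `J = {H, X}` for the energy first moment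
  `X = Σ_k k e_k` (`sum_bondCurrent_eq_poisson`), so `w = u + X` is a `C²` first integral of the CLOSED
  chain blind to `p_0`, hence constant-like by helper I (`poisson_hamiltonian_rigidity`) — contradicting
  `∂_{p_{N-1}} w = (N-1) p_{N-1} ≢ 0`.
* `tapEnergy_pos`, `tapEnergy_pos_gibbsWeight` / `tapEnergy_pos_gibbs` (registered form) — hence for
  every measure charging all Lebesgue-non-null sets (in particular `CorrectorTheory`'s unnormalised
  Gibbs weight `μ_T = e^{-H/T}dx`) with finite tap energies,
  `0 < ∫(∂_{p_0}u)² dμ + ∫(∂_{p_{N-1}}u)² dμ` — the form in which (A6) is consumed.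

WHAT REMAINS between `CorrectorTheory` and the stub (each ≤ M, recorded for the prover of 14071/11750):
(1) Fubini/limit `∫₀^∞∫ J·P_tJ dπ_T dt = Z⁻¹⟨J, u⟩_{μ_T}` from (B), (A3), (A4); (2) the corrector
equation CLASSICALLY with `u ∈ C²` ((A1) exports `C¹` only: weak equation + in-tree Hörmander
`exists_contDiff_ae_eq_of_weak_resolvent`); (3) `∂_{p_b}u ∈ L²(μ_T)`; then `tapEnergy_pos_gibbs`
gives `0 < D_N`. Sources: ReyBellet2003 Rem 4.4; KunduDharNarayan2009; refuter write-up on stmt-11750.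
-/

noncomputable section

open Finset
open scoped BigOperators ContDiff

namespace Summit.AtomisticToContinuum.FouriersLaw.Cruxes.BoundedResponseConverges.TwoScaleGluingLogRigidity.Stubs

open Literature.MathematicalPhysics.KineticTheory.HeatConduction
open Literature.MathematicalPhysics.KineticTheory.HeatConduction.OscillatorChain
open Literature.Barriers.AtomisticToContinuum
open Literature.Barriers.AtomisticToContinuum.OpenChain

variable {N : ℕ}

/-! ### Non-degeneracy of the Kubo corrector -/

/-- The energy first moment `X = Σ_k k·e_k` is as smooth as the potentials. [folklore] -/
theorem contDiff_energyMoment (P : OscillatorChain) {n : WithTop ℕ∞} (hU : ContDiff ℝ n P.U)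
    (hV : ContDiff ℝ n P.V) (N : ℕ) : ContDiff ℝ n (energyMoment P N) := by
  unfold energyMoment
  have hq : ∀ i : Fin N, ContDiff ℝ n fun x : PhaseSpace N => x.1 i := fun i =>
    (contDiff_apply ℝ ℝ i).comp contDiff_fst
  have hp : ∀ i : Fin N, ContDiff ℝ n fun x : PhaseSpace N => x.2 i := fun i =>
    (contDiff_apply ℝ ℝ i).comp contDiff_snd
  apply ContDiff.add
  · exact ContDiff.sum fun k _ =>
      contDiff_const.mul ((((hp k).pow 2).div_const 2).add (hU.comp (hq k)))
  · refine ContDiff.sum fun k _ => ContDiff.sum fun l _ => ?_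
    by_cases h : l.val = k.val + 1
    · simp only [h, if_true]
      exact contDiff_const.mul (hV.comp ((hq l).sub (hq k)))
    · simp only [h, if_false]
      exact contDiff_const

/-- With both contact derivatives silent, the Langevin generator reduces to the Liouvillian
`{H, ·}` (any bath temperatures, any coupling). [folklore] -/
theorem generator_eq_poisson_of_partialP_baths_eq_zero (P : OscillatorChain) (hN : 2 ≤ N)
    (T_L T_R : ℝ) {u : PhaseSpace N → ℝ}
    (h0 : ∀ x, partialP (⟨0, by omega⟩ : Fin N) u x = 0)
    (h1 : ∀ x, partialP (⟨N - 1, by omega⟩ : Fin N) u x = 0) (x : PhaseSpace N) :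
    P.generator N T_L T_R u x = poisson (P.hamiltonian N) u x := by
  have e0 : ∀ i : Fin N, i.val = 0 → partialP i u = fun _ => 0 := fun i hi => by
    funext y
    have : i = ⟨0, by omega⟩ := Fin.ext hi
    rw [this]
    exact h0 y
  have e1 : ∀ i : Fin N, i.val = N - 1 → partialP i u = fun _ => 0 := fun i hi => by
    funext y
    have : i = ⟨N - 1, by omega⟩ := Fin.ext hi
    rw [this]
    exact h1 y
  unfold OscillatorChain.generator poisson
  have hsum0 : (∑ i : Fin N,
      ((if i.val = 0 then T_L * partialP i (partialP i u) x - x.2 i * partialP i u x else 0) +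
        (if i.val = N - 1 then T_R * partialP i (partialP i u) x - x.2 i * partialP i u x else 0))) = 0 := by
    refine Finset.sum_eq_zero fun i _ => ?_
    have t0 : (if i.val = 0 then T_L * partialP i (partialP i u) x - x.2 i * partialP i u x else 0) = 0 := by
      split_ifs with ha
      · rw [e0 i ha]
        simp [partialP_const]
      · rfl
    have t1 : (if i.val = N - 1 then T_R * partialP i (partialP i u) x - x.2 i * partialP i u x else 0)
        = 0 := by
      split_ifs with hb
      · rw [e1 i hb]
        simp [partialP_const]
      · rfl
    rw [t0, t1, add_zero]
  rw [hsum0, mul_zero, add_zero]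
  refine Finset.sum_congr rfl fun i _ => ?_
  rw [OscillatorChain.partialP_hamiltonian]

/-- **Non-degeneracy of the Kubo corrector (the strictness half of `PositiveConductance`).**
For the pinned chain (`β ≥ 0`, any `ω₂, lam, γ`, any bath temperatures) with `N ≥ 2` sites, a `C²`
solution `u` of the corrector equation `L u = -J_tot` (`J_tot = Σ_i j_i`) cannot have BOTH contact
momentum derivatives identically zero: otherwise `w = u + X` (`X = Σ_k k e_k`, `{H, X} = J_tot`) is a
`C²` first integral of the closed chain blind to `p_0`, hence has all derivatives zero by
`poisson_hamiltonian_rigidity`, contradicting `∂_{p_{N-1}} w = (N-1) p_{N-1}`. Consequently the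
tap energy `γT (‖∂_{p_0}u‖² + ‖∂_{p_{N-1}}u‖²) = ⟨u, J_tot⟩ = (N-1)T²Z·D_N` (CorrectorTheory (A6)+(B))
is STRICTLY positive once the corrector equation holds classically. [folklore] -/
theorem corrector_nondegenerate {ω₂ lam β : ℝ} (hβ : 0 ≤ β) (γ T_L T_R : ℝ) (hN : 2 ≤ N)
    {u : PhaseSpace N → ℝ} (hu : ContDiff ℝ 2 u)
    (hLu : ∀ x, (pinnedChain ω₂ lam β γ).generator N T_L T_R u x =
      -∑ i : Fin N, (pinnedChain ω₂ lam β γ).bondCurrent N i x)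
    (h0 : ∀ x, partialP (⟨0, by omega⟩ : Fin N) u x = 0)
    (h1 : ∀ x, partialP (⟨N - 1, by omega⟩ : Fin N) u x = 0) : False := by
  set P := pinnedChain ω₂ lam β γ with hP
  have hU1 : Differentiable ℝ P.U :=
    (pinnedChain_contDiff_U ω₂ lam β γ (n := 1)).differentiable one_ne_zero
  have hV1 : Differentiable ℝ P.V :=
    (pinnedChain_contDiff_V ω₂ lam β γ (n := 1)).differentiable one_ne_zero
  have hud : Differentiable ℝ u := hu.differentiable (by norm_num)
  have hX : ContDiff ℝ 2 (energyMoment P N) :=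
    contDiff_energyMoment P (pinnedChain_contDiff_U ω₂ lam β γ) (pinnedChain_contDiff_V ω₂ lam β γ) N
  have hXd : Differentiable ℝ (energyMoment P N) := hX.differentiable (by norm_num)
  -- `{H, u + X} = 0`
  have hHw : ∀ x, poisson (P.hamiltonian N) (u + energyMoment P N) x = 0 := by
    intro x
    rw [poisson_add_right _ hud hXd,
      ← generator_eq_poisson_of_partialP_baths_eq_zero P hN T_L T_R h0 h1 x, hLu x,
      sum_bondCurrent_eq_poisson P hU1 hV1]
    ring
  have hw : ContDiff ℝ 2 (u + energyMoment P N) := hu.add hX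
  have hw0 : ∀ i : Fin N, i.val = 0 → ∀ z, partialP i (u + energyMoment P N) z = 0 := by
    intro i hi z
    rw [partialP_add hud hXd, partialP_energyMoment, hi]
    have : i = ⟨0, by omega⟩ := Fin.ext hi
    rw [this, h0]
    simp
  -- rigidity: `∂_{p_{N-1}} (u + X) = 0` at the point `q = 0`, `p = 1`
  have key := (poisson_hamiltonian_rigidity ω₂ lam hβ γ hw hHw hw0 ⟨N - 1, by omega⟩
    ((fun _ => 0, fun _ => 1) : PhaseSpace N)).1
  rw [partialP_add hud hXd, h1, partialP_energyMoment, zero_add] at key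
  simp only [mul_one] at key
  have hc : (N - 1 : ℕ) = 0 := by exact_mod_cast key
  omega

/-! ### From `L²` tap energies to the pointwise statement -/

open MeasureTheory in
/-- **Strictly positive tap energy.** Under the hypotheses of `corrector_nondegenerate`, for every
measure `μ` on phase space that charges every Lebesgue-non-null set (`volume ≪ μ`; e.g. the Gibbs
weight `e^{-H/T} dx` or the Gibbs probability measure) and for which the two tap energies are finite,
`∫ (∂_{p_0} u)² dμ + ∫ (∂_{p_{N-1}} u)² dμ > 0`: if the sum vanished, both continuous integrands would
vanish `μ`-a.e., hence Lebesgue-a.e., hence everywhere. This is the form in which the tap energy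
identity `γT(∫(∂_{p_0}u)² + ∫(∂_{p_{N-1}}u)²) = ∫ u J_tot` (CorrectorTheory (A6)) is consumed. [folklore] -/
theorem tapEnergy_pos {ω₂ lam β : ℝ} (hβ : 0 ≤ β) (γ T_L T_R : ℝ) (hN : 2 ≤ N)
    {u : PhaseSpace N → ℝ} (hu : ContDiff ℝ 2 u)
    (hLu : ∀ x, (pinnedChain ω₂ lam β γ).generator N T_L T_R u x =
      -∑ i : Fin N, (pinnedChain ω₂ lam β γ).bondCurrent N i x)
    (μ : Measure (PhaseSpace N)) (hμ : (volume : Measure (PhaseSpace N)) ≪ μ)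
    (hi₀ : Integrable (fun x => (partialP (⟨0, by omega⟩ : Fin N) u x) ^ 2) μ)
    (hi₁ : Integrable (fun x => (partialP (⟨N - 1, by omega⟩ : Fin N) u x) ^ 2) μ) :
    0 < (∫ x, (partialP (⟨0, by omega⟩ : Fin N) u x) ^ 2 ∂μ) +
      ∫ x, (partialP (⟨N - 1, by omega⟩ : Fin N) u x) ^ 2 ∂μ := by
  haveI := isAddHaarMeasure_volume_phaseSpace N
  set b₀ : Fin N := ⟨0, by omega⟩ with hb₀
  set b₁ : Fin N := ⟨N - 1, by omega⟩ with hb₁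
  have hc : ∀ b : Fin N, Continuous fun x => (partialP b u x) ^ 2 := fun b =>
    (continuous_partialP hu (by norm_num) b).pow 2
  have hnn : ∀ b : Fin N, 0 ≤ ∫ x, (partialP b u x) ^ 2 ∂μ := fun b =>
    integral_nonneg fun x => sq_nonneg _
  -- if an integral vanishes, the contact derivative vanishes identically
  have hzero : ∀ b : Fin N, Integrable (fun x => (partialP b u x) ^ 2) μ →
      ∫ x, (partialP b u x) ^ 2 ∂μ = 0 → ∀ x, partialP b u x = 0 := by
    intro b hib hI x
    have hae : (fun x => (partialP b u x) ^ 2) =ᵐ[μ] 0 :=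
      (integral_eq_zero_iff_of_nonneg (fun x => sq_nonneg _) hib).1 hI
    have hae' : (fun x => (partialP b u x) ^ 2) =ᵐ[volume] (fun _ => (0 : ℝ)) := hμ.ae_eq hae
    have heq : (fun x => (partialP b u x) ^ 2) = fun _ => (0 : ℝ) :=
      ((hc b).ae_eq_iff_eq volume continuous_const).1 hae'
    have := congrFun heq x
    simpa using this
  by_contra h
  have h0 : ∫ x, (partialP b₀ u x) ^ 2 ∂μ = 0 := by
    have := hnn b₀; have := hnn b₁; linarith
  have h1 : ∫ x, (partialP b₁ u x) ^ 2 ∂μ = 0 := by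
    have := hnn b₀; have := hnn b₁; linarith
  exact corrector_nondegenerate hβ γ T_L T_R hN hu hLu (hzero b₀ hi₀ h0) (hzero b₁ hi₁ h1)

open MeasureTheory in
/-- `tapEnergy_pos` for the unnormalised Gibbs weight `μ_T = e^{-H/T} dx` of `CorrectorTheory`
(its conjunct (A6) is stated for exactly this measure): Lebesgue measure is absolutely continuous
with respect to it since the density is everywhere positive. [folklore] -/
theorem tapEnergy_pos_gibbsWeight {ω₂ lam β : ℝ} (hβ : 0 ≤ β) (γ T_L T_R T : ℝ) (hN : 2 ≤ N)
    {u : PhaseSpace N → ℝ} (hu : ContDiff ℝ 2 u)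
    (hLu : ∀ x, (pinnedChain ω₂ lam β γ).generator N T_L T_R u x =
      -∑ i : Fin N, (pinnedChain ω₂ lam β γ).bondCurrent N i x)
    (hi₀ : Integrable (fun x => (partialP (⟨0, by omega⟩ : Fin N) u x) ^ 2)
      ((volume : Measure (PhaseSpace N)).withDensity fun x =>
        ENNReal.ofReal (Real.exp (-((pinnedChain ω₂ lam β γ).hamiltonian N x) / T))))
    (hi₁ : Integrable (fun x => (partialP (⟨N - 1, by omega⟩ : Fin N) u x) ^ 2)
      ((volume : Measure (PhaseSpace N)).withDensity fun x =>
        ENNReal.ofReal (Real.exp (-((pinnedChain ω₂ lam β γ).hamiltonian N x) / T)))) :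
    0 < (∫ x, (partialP (⟨0, by omega⟩ : Fin N) u x) ^ 2
        ∂((volume : Measure (PhaseSpace N)).withDensity fun x =>
          ENNReal.ofReal (Real.exp (-((pinnedChain ω₂ lam β γ).hamiltonian N x) / T)))) +
      ∫ x, (partialP (⟨N - 1, by omega⟩ : Fin N) u x) ^ 2
        ∂((volume : Measure (PhaseSpace N)).withDensity fun x =>
          ENNReal.ofReal (Real.exp (-((pinnedChain ω₂ lam β γ).hamiltonian N x) / T))) := by
  refine tapEnergy_pos hβ γ T_L T_R hN hu hLu _ ?_ hi₀ hi₁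
  refine withDensity_absolutelyContinuous' ?_ (Filter.Eventually.of_forall fun x => ?_)
  · have hH : Continuous ((pinnedChain ω₂ lam β γ).hamiltonian N) :=
      (pinnedChain ω₂ lam β γ).continuous_hamiltonian (pinnedChain_contDiff_U ω₂ lam β γ (n := 0)).continuous
        (pinnedChain_contDiff_V ω₂ lam β γ (n := 0)).continuous N
    exact ((hH.neg.div_const T).rexp).measurable.ennreal_ofReal.aemeasurable
  · exact (ENNReal.ofReal_pos.2 (Real.exp_pos _)).ne'


/-! ### Registered forms (sub-goals of stub `stub_positiveConductance`) -/

/-- **Registered form of `corrector_nondegenerate`** (sub-goal `corrector_nondegeneracy`): contact sites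
given by value (`b₀ = 0`, `b₁ = N - 1`) as in `CorrectorTheory` (A6). [folklore] -/
theorem corrector_nondegeneracy :
    ∀ (ω₂ lam β γ T_L T_R : ℝ), 0 ≤ β → ∀ (N : ℕ), 2 ≤ N → ∀ (u : PhaseSpace N → ℝ), ContDiff ℝ 2 u →
      (∀ x, (pinnedChain ω₂ lam β γ).generator N T_L T_R u x =
        -∑ i : Fin N, (pinnedChain ω₂ lam β γ).bondCurrent N i x) →
      ∀ b₀ b₁ : Fin N, b₀.val = 0 → b₁.val = N - 1 →
      (∀ x, partialP b₀ u x = 0) → (∀ x, partialP b₁ u x = 0) → False := by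
  intro ω₂ lam β γ T_L T_R hβ N hN u hu hLu b₀ b₁ hb₀ hb₁ h0 h1
  obtain ⟨v₀, hv₀⟩ := b₀
  obtain ⟨v₁, hv₁⟩ := b₁
  change v₀ = 0 at hb₀
  change v₁ = N - 1 at hb₁
  subst hb₀ hb₁
  exact corrector_nondegenerate hβ γ T_L T_R hN hu hLu h0 h1

open MeasureTheory in
/-- **Registered form of `tapEnergy_pos_gibbsWeight`** (sub-goal `tapEnergy_pos_gibbs`): strictly
positive tap energy w.r.t. the unnormalised Gibbs weight `e^{-H/T}dx`, contact sites by value. [folklore] -/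
theorem tapEnergy_pos_gibbs :
    ∀ (ω₂ lam β γ T_L T_R T : ℝ), 0 ≤ β → ∀ (N : ℕ), 2 ≤ N → ∀ (u : PhaseSpace N → ℝ), ContDiff ℝ 2 u →
      (∀ x, (pinnedChain ω₂ lam β γ).generator N T_L T_R u x =
        -∑ i : Fin N, (pinnedChain ω₂ lam β γ).bondCurrent N i x) →
      ∀ b₀ b₁ : Fin N, b₀.val = 0 → b₁.val = N - 1 →
      Integrable (fun x => (partialP b₀ u x) ^ 2)
        ((volume : Measure (PhaseSpace N)).withDensity fun x =>
          ENNReal.ofReal (Real.exp (-((pinnedChain ω₂ lam β γ).hamiltonian N x) / T))) →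
      Integrable (fun x => (partialP b₁ u x) ^ 2)
        ((volume : Measure (PhaseSpace N)).withDensity fun x =>
          ENNReal.ofReal (Real.exp (-((pinnedChain ω₂ lam β γ).hamiltonian N x) / T))) →
      0 < (∫ x, (partialP b₀ u x) ^ 2
          ∂((volume : Measure (PhaseSpace N)).withDensity fun x =>
            ENNReal.ofReal (Real.exp (-((pinnedChain ω₂ lam β γ).hamiltonian N x) / T)))) +
        ∫ x, (partialP b₁ u x) ^ 2
          ∂((volume : Measure (PhaseSpace N)).withDensity fun x =>
            ENNReal.ofReal (Real.exp (-((pinnedChain ω₂ lam β γ).hamiltonian N x) / T))) := by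
  intro ω₂ lam β γ T_L T_R T hβ N hN u hu hLu b₀ b₁ hb₀ hb₁ hi₀ hi₁
  obtain ⟨v₀, hv₀⟩ := b₀
  obtain ⟨v₁, hv₁⟩ := b₁
  change v₀ = 0 at hb₀
  change v₁ = N - 1 at hb₁
  subst hb₀ hb₁
  exact tapEnergy_pos_gibbsWeight hβ γ T_L T_R T hN hu hLu hi₀ hi₁

end Summit.AtomisticToContinuum.FouriersLaw.Cruxes.BoundedResponseConverges.TwoScaleGluingLogRigidity.Stubs

end
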